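import Summits.AtomisticToContinuum.BoseEinsteinCondensation.Theses.BECRieszReverseHolder
import Literature.MathematicalPhysics.StatisticalMechanics.PeriodicRieszKernelFourier
import Literature.MathematicalPhysics.QuantumManyBody.OnsagerInequality

/-!
# Onsager's bound for the smeared periodic Riesz kernel (route BECRieszReverseHolder)

Line `registered` of crux stmt-AtomisticToContinuum-12840 `CoarseGrainedReverseHolder`; registered
sub-goal `stub_rieszKernelOnsagerBound` serving the stub `stub_rieszShadowFieldMoment` (= route item
stmt-AtomisticToContinuum-12841 `RieszShadowFieldMoment`, whose kernel is `periodicRieszKernel 2 L η`).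

The smeared, zero-mean, `Lℤ³`-periodic Riesz-`s` kernel `g = periodicRieszKernel s L η` (`0 < s`,
`0 < L`, `η ≠ 0`) is positive-definite for ALL real weights — not only for neutral ones as in
`sum_sum_mul_periodicRieszKernel_nonneg`: the cell average subtracted in `periodicHeatSum` is exactly the
zero mode of the torus heat kernel, so `Σ_{i,j} c_i c_j Θ_{L,t}(z_i - z_j) = L⁻³ Σ_{k ≠ 0}
e^{-4π²|k|²t/L²} |Σ_i c_i e_k(z_i/L)|² ≥ 0`. With unit weights this is **Onsager's bound**
`Σ_{i<j} g(X_i - X_j) ≥ -N g(0)/2` for every configuration — the stability estimate behind the uniform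
field-moment bound of `RieszShadowFieldMoment` (Lewin 2022; Serfaty 2024, Ch. 3–4).
-/

namespace Summit.AtomisticToContinuum.BoseEinsteinCondensation.Theorems.CoarseGrainedReverseHolder

open Summit.AtomisticToContinuum.BoseEinsteinCondensation.Theses.BECRieszReverseHolder
open MeasureTheory Real UnitAddTorus
open Literature.MathematicalPhysics.StatisticalMechanics Literature.Analysis.UnboundedOperators
open Literature.Analysis.FunctionSpaces
open Literature.MathematicalPhysics.QuantumManyBody BoseGas

/-! ## Positive type for all weights, and Onsager's bound -/

/-- The torus heat kernel dominates its zero mode as a quadratic form: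
`(Σ_i c_i)² ≤ Σ_{i,j} c_i c_j p_τ(y_i - y_j)` (`τ > 0`), since
`Σ_{i,j} c_i c_j p_τ(y_i - y_j) = Σ_k e^{-4π²|k|²τ} |Σ_i c_i e^{2πik·y_i}|²` and the `k = 0` term is
`(Σ_i c_i)²`. -/
theorem sq_sum_le_sum_sum_mul_torusHeatKernel {d : Type*} [Fintype d] {τ : ℝ} (hτ : 0 < τ) {m : ℕ}
    (y : Fin m → UnitAddTorus d) (c : Fin m → ℝ) :
    (∑ i, c i) ^ 2 ≤ ∑ i, ∑ j, c i * c j * Torus.heatKernel τ (y i - y j) := by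
  classical
  -- adapted from `Literature.MathematicalPhysics.StatisticalMechanics.sum_sum_mul_torusHeatKernel_nonneg`
  set A : (d → ℤ) → ℂ := fun k => ∑ i, (c i : ℂ) * mFourier k (y i) with hA
  have hpair : ∀ i j, HasSum (fun k : d → ℤ => (c i : ℂ) * mFourier k (y i) *
      ((starRingEnd ℂ) ((c j : ℂ) * mFourier k (y j))) * ((Torus.heatCoeff τ k : ℝ) : ℂ))
      ((c i : ℂ) * (c j : ℂ) * Torus.heatKernelC τ (y i - y j)) := by
    intro i j
    refine ((Torus.hasSum_heatKernelC hτ (y i - y j)).mul_left ((c i : ℂ) * (c j : ℂ))).congr_fun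
      fun k => ?_
    rw [sub_eq_add_neg, Torus.mFourier_apply_add, mFourier_apply_neg, map_mul, Complex.conj_ofReal,
      smul_eq_mul]
    ring
  have hsum : HasSum (fun k : d → ℤ => ∑ i, ∑ j, (c i : ℂ) * mFourier k (y i) *
      ((starRingEnd ℂ) ((c j : ℂ) * mFourier k (y j))) * ((Torus.heatCoeff τ k : ℝ) : ℂ))
      (∑ i, ∑ j, (c i : ℂ) * (c j : ℂ) * Torus.heatKernelC τ (y i - y j)) :=
    hasSum_sum fun i _ => hasSum_sum fun j _ => hpair i j
  have hterm : ∀ k : d → ℤ, ∑ i, ∑ j, (c i : ℂ) * mFourier k (y i) *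
      ((starRingEnd ℂ) ((c j : ℂ) * mFourier k (y j))) * ((Torus.heatCoeff τ k : ℝ) : ℂ) =
      ((Torus.heatCoeff τ k * ‖A k‖ ^ 2 : ℝ) : ℂ) := by
    intro k
    rw [Complex.ofReal_mul, Complex.ofReal_pow, ← Complex.mul_conj', hA, map_sum, Finset.sum_mul_sum,
      Finset.mul_sum]
    refine Finset.sum_congr rfl fun i _ => ?_
    rw [Finset.mul_sum]
    refine Finset.sum_congr rfl fun j _ => ?_
    ring
  have hval : ∑ i, ∑ j, (c i : ℂ) * (c j : ℂ) * Torus.heatKernelC τ (y i - y j) =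
      ((∑ i, ∑ j, c i * c j * Torus.heatKernel τ (y i - y j) : ℝ) : ℂ) := by
    push_cast
    refine Finset.sum_congr rfl fun i _ => Finset.sum_congr rfl fun j _ => ?_
    rw [Torus.ofReal_heatKernel hτ]
  have hsum' : HasSum (fun k : d → ℤ => ((Torus.heatCoeff τ k * ‖A k‖ ^ 2 : ℝ) : ℂ))
      (((∑ i, ∑ j, c i * c j * Torus.heatKernel τ (y i - y j) : ℝ) : ℂ)) := by
    rw [← hval]
    refine hsum.congr_fun fun k => ?_
    simp only [hterm]
  have hreal := Complex.hasSum_ofReal.1 hsum'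
  have h0 : Torus.heatCoeff τ (0 : d → ℤ) * ‖A 0‖ ^ 2 = (∑ i, c i) ^ 2 := by
    rw [Torus.heatCoeff_zero_right, one_mul, hA]
    simp only [mFourier_zero, ContinuousMap.one_apply, mul_one]
    rw [← Complex.ofReal_sum, Complex.norm_real, Real.norm_eq_abs, sq_abs]
  calc (∑ i, c i) ^ 2 = ∑ k ∈ ({0} : Finset (d → ℤ)), Torus.heatCoeff τ k * ‖A k‖ ^ 2 := by
        rw [Finset.sum_singleton, h0]
    _ ≤ _ := sum_le_hasSum _ (fun k _ => mul_nonneg (Torus.heatCoeff_pos τ k).le (sq_nonneg _)) hreal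

/-- **`Θ_{L,t}` is positive-definite, unconditionally**: for all real weights,
`0 ≤ Σ_{i,j} c_i c_j Θ_{L,t}(z_i - z_j)` (`L, t > 0`; the subtracted cell average is exactly the
zero mode of the torus heat kernel). -/
theorem sum_sum_mul_periodicHeatSum_nonneg' {L t : ℝ} (hL : 0 < L) (ht : 0 < t) {m : ℕ}
    (z : Fin m → EuclideanSpace ℝ (Fin 3)) (c : Fin m → ℝ) :
    0 ≤ ∑ i, ∑ j, c i * c j * periodicHeatSum L t (z i - z j) := by
  rw [sum_sum_mul_periodicHeatSum_eq hL ht, ← mul_sub]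
  refine mul_nonneg (by positivity) (sub_nonneg.2 ?_)
  exact sq_sum_le_sum_sum_mul_torusHeatKernel (by positivity) _ c

/-- **The periodic Riesz kernel is positive-definite, unconditionally** (`0 < s`, `0 < L`,
`η ≠ 0`): for all points `z_i` and all real weights `c_i`,
`0 ≤ Σ_{i,j} c_i c_j g(z_i - z_j)` (`ĝ(k) > 0` for `k ≠ 0` and `ĝ(0) = 0`). -/
theorem sum_sum_mul_periodicRieszKernel_nonneg' {s L η : ℝ} (hs : 0 < s) (hL : 0 < L) (hη : η ≠ 0)
    {m : ℕ} (z : Fin m → EuclideanSpace ℝ (Fin 3)) (c : Fin m → ℝ) :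
    0 ≤ ∑ i, ∑ j, c i * c j * periodicRieszKernel s L η (z i - z j) := by
  have hη2 : 0 < η ^ 2 := by positivity
  rw [sum_sum_mul_periodicRieszKernel_eq hL hη]
  refine mul_nonneg (rieszSubordinationConst_pos hs).le
    (setIntegral_nonneg measurableSet_Ioi fun t ht => ?_)
  have ht0 : 0 < t := hη2.trans ht
  exact mul_nonneg (Real.rpow_nonneg ht0.le _) (sum_sum_mul_periodicHeatSum_nonneg' hL ht0 z c)

/-- **Onsager's bound for the smeared periodic Riesz gas**: for every configuration,
`Σ_{i<j} g(X_i - X_j) ≥ -N g(0)/2` (`g = periodicRieszKernel s L η`, `0 < s`, `0 < L`, `η ≠ 0`):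
positive-definiteness with unit weights, `0 ≤ Σ_{i,j} g(X_i - X_j) = N g(0) + 2 Σ_{i<j} g(X_i - X_j)`. -/
theorem stub_rieszKernelOnsagerBound : ∀ (s L η : ℝ), 0 < s → 0 < L → η ≠ 0 → ∀ (N : ℕ) (X : Fin N → EuclideanSpace ℝ (Fin 3)), -((N : ℝ) * Literature.MathematicalPhysics.StatisticalMechanics.periodicRieszKernel s L η 0 / 2) ≤ ∑ i : Fin N, ∑ j : Fin N with i < j, Literature.MathematicalPhysics.StatisticalMechanics.periodicRieszKernel s L η (X i - X j) := by
  intro s L η hs hL hη N X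
  have h := sum_sum_mul_periodicRieszKernel_nonneg' hs hL hη X (fun _ => (1 : ℝ))
  simp only [one_mul] at h
  rw [Coulomb.sum_sum_eq_diag_add_two_mul (fun i j => periodicRieszKernel s L η (X i - X j))
    (fun i j => periodicRieszKernel_sub_comm s L η (X i) (X j))] at h
  simp only [sub_self, Finset.sum_const, Finset.card_univ, Fintype.card_fin, nsmul_eq_mul] at h
  linarith


end Summit.AtomisticToContinuum.BoseEinsteinCondensation.Theorems.CoarseGrainedReverseHolder
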